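import Summits.CriticalPhenomena.CardyFormulaZ2.Theses.CardyComplexCone
import Literature.Probability.Percolation.InterfaceScalingLimitDiscretised
import Literature.Probability.LatticeModels.MedialInterfaceMeasurability
import Literature.Probability.RandomPlanarGeometry.SLEConvergenceCriterion
import Literature.Probability.RandomPlanarGeometry.SLEUniquenessInLaw
import Literature.Probability.RandomPlanarGeometry.SLEExistenceNeEightHolds
import Literature.Probability.RandomPlanarGeometry.ObservableLimitPassage
import Literature.Probability.RandomPlanarGeometry.LoewnerDescription
import Literature.Probability.LatticeModels.FKIsingInterfaceSLEAssembly
import HarnessLib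

/-!
# Vocabulary of line `caratheodory-net-slit-uniformity` for crux `ParafermionToSLESixFamilies` (stmt-CriticalPhenomena-11389)

Route `CardyComplexCone` (sub-problem `CriticalPhenomena/CardyFormulaZ2`), crux
`Summit.CriticalPhenomena.CardyFormulaZ2.Theses.CardyComplexCone.ParafermionToSLESixFamilies`
(item stmt-CriticalPhenomena-11389; literally `WeakHolFamilies → PrecompactFamilies → SLESixAllFamilies`,
the three blocks below). This file is the **definitions module** of the checked skeleton
`Cruxes/ParafermionToSLESixFamilies/Lines/caratheodory_net_slit_uniformity.lean` (planner
`planner-cruxplan-stmt-CriticalPhenomena-11389-caratheodory-net-sli-0`, lead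
`prover-line-stmt-CriticalPhenomena-11389-0`, `ledger skeleton check` OK, six registered stubs
`stub_koebeShadowSquares`, `stub_carrierEquicontinuity`, `stub_identifiedLimit`,
`stub_slitMartingaleData`, `stub_sleSixOfLimitData`, `stub_tightFamilies`): it carries, verbatim and
sorry-free, the skeleton's VOCABULARY — the three blocks of the crux (`WeakHolFamilies`,
`PrecompactFamilies`, `SLESixAllFamilies`), the observable `obs` / its start-anchored form `aobs`
(`startAngle`), square resampling `splice` / `condObs` / `latticeBox`, the spin-`1/3` half-plane
observable `paraObservable` / `paraObservableProcess`, and the typed stub statements as named `Prop`s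
(`KoebeShadowSquares`, `CarrierEquicontinuity`, `IdentifiedLimit`, `UniformPrecompact`,
`ParaMartingaleApprox`, `SlitMartingaleData`, `SleSixOfLimitData`, `TightFamilies`) — so that the stub
helper files `Theorems/CardyComplexConeParafermionToSLESixFamilies<Stub>.lean` (each proving
`theorem stub_<x> : <signature>` by name, `--supports stmt-CriticalPhenomena-11389`) and the closing
skeleton file share ONE copy of every object. NOTHING in this file is asserted: every `def … : Prop` is a
statement to be proved by a registered stub or consumed as a hypothesis by one (two of them,
`KoebeShadowSquares` and `IdentifiedLimit`, are of conjecture strength — DCS 2012 Conj. 8.7 in family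
form and its conditional square envelope — and are recorded as such in the skeleton and in PICKED.md).
The companion `Theorems/CardyComplexConeDefs.lean` (line `qkz-strip-boundary-arm` of crux
`EdgePrecompact`) is at the 400-line cap, hence this second definitions module of the route.

Sources: H. Duminil-Copin, S. Smirnov, *Conformal invariance of lattice models*, arXiv:1109.1549, §8.3
(Conj. 8.7–8.8 at `q = 1`); H. Duminil-Copin, arXiv:1208.3787, Prop. 4–5 and p. 9 (spin `1/3`,
`κ = 6`); A. Kemppainen, S. Smirnov, Ann. Probab. 45 (2017), Thm 1.5 / Cor 1.7; D. Chelkak et al.,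
C. R. Math. 352 (2014), §3; C. Garban, G. Pete, O. Schramm, J. AMS 26 (2013), §§3–5; M. Aizenman,
A. Burchard, Duke Math. J. 99 (1999), Thm 1.2.
-/

noncomputable section

open scoped Topology NNReal ENNReal BoundedContinuousFunction
open Filter Set MeasureTheory
open Literature.Probability Literature.Probability.LatticeModels Literature.Probability.Percolation
open Literature.Probability.RandomPlanarGeometry
open scoped Literature.Probability.RandomPlanarGeometry.PathBorel

namespace Summit.CriticalPhenomena.CardyFormulaZ2.Cruxes.ParafermionToSLESixFamilies.CaratheodoryNetSlitUniformity

/-! ## §0 The three blocks of the crux, verbatim (as in `Disproof.lean` §0) -/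

/-- Hypothesis A of the crux (weak holomorphy of the spin-1/3 vertex parafermion at scale
`δ^{1/3}`, family form), verbatim. -/
def WeakHolFamilies : Prop :=
  ∀ (D : Literature.Probability.RandomPlanarGeometry.DobrushinDomain) (Λ : ℝ → Literature.Probability.LatticeModels.DiscreteDobrushin), (∀ δ, (Λ δ).Ω = D.carrier) → (∀ δ, (Λ δ).δ = δ) → (∀ᶠ δ in 𝓝[>] (0:ℝ), (Λ δ).IsZdAdmissible) → ∀ (φ : ℂ → ℂ), ContDiff ℝ (⊤ : ℕ∞) φ → HasCompactSupport φ → tsupport φ ⊆ D.carrier → Tendsto (fun δ : ℝ => ((δ ^ ((5:ℝ) / 3) : ℝ) : ℂ) * ∑ᶠ z : Literature.Probability.LatticeModels.MedialVertex, (∫ ω, Literature.Probability.LatticeModels.MedialPath.passageSum (Literature.Probability.LatticeModels.medialExploration (Λ δ) ω) δ (1 / 3) z ∂(Literature.Probability.Percolation.bondPercolation (Literature.Probability.LatticeModels.zdGraph 2) Literature.Probability.Percolation.half)) * ((fderiv ℝ φ (Literature.Probability.LatticeModels.medialPoint δ z) 1 + Complex.I * fderiv ℝ φ (Literature.Probability.LatticeModels.medialPoint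 δ z) Complex.I) / 2)) (𝓝[>] (0:ℝ)) (𝓝 0)

/-- Hypothesis B of the crux (local boundedness + equicontinuity of `δ^{-1/3}F_δ` on lattice edges,
family form, edge-guarded rev 3), verbatim. -/
def PrecompactFamilies : Prop :=
  ∀ (D : Literature.Probability.RandomPlanarGeometry.DobrushinDomain) (Λ : ℝ → Literature.Probability.LatticeModels.DiscreteDobrushin), (∀ δ, (Λ δ).Ω = D.carrier) → (∀ δ, (Λ δ).δ = δ) → (∀ᶠ δ in 𝓝[>] (0:ℝ), (Λ δ).IsZdAdmissible) → let F : ℝ → Literature.Probability.LatticeModels.MedialVertex → ℂ := fun δ z => ∫ ω, Literature.Probability.LatticeModels.MedialPath.passageSum (Literature.Probability.LatticeModels.medialExploration (Λ δ) ω) δ (1 / 3) z ∂(Literature.Probability.Percolation.bondPercolation (Literature.Probability.LatticeModels.zdGraph 2) Literature.Probability.Percolation.half); ∀ K : Set ℂ, IsCompact K → K ⊆ D.carrier → (∃ C : ℝ, ∀ᶠ δ in 𝓝[>] (0:ℝ), ∀ z : Literature.Probability.LatticeModels.MedialVertex, z ∈ (Literature.Probability.LatticeModels.zdGraph 2).edgeSet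 → Literature.Probability.LatticeModels.medialPoint δ z ∈ K → ‖F δ z‖ ≤ C * δ ^ ((1:ℝ) / 3)) ∧ (∀ ε > (0:ℝ), ∃ η > (0:ℝ), ∀ᶠ δ in 𝓝[>] (0:ℝ), ∀ z z' : Literature.Probability.LatticeModels.MedialVertex, z ∈ (Literature.Probability.LatticeModels.zdGraph 2).edgeSet → z' ∈ (Literature.Probability.LatticeModels.zdGraph 2).edgeSet → Literature.Probability.LatticeModels.medialPoint δ z ∈ K → Literature.Probability.LatticeModels.medialPoint δ z' ∈ K → dist (Literature.Probability.LatticeModels.medialPoint δ z) (Literature.Probability.LatticeModels.medialPoint δ z') < η → ‖F δ z - F δ z'‖ ≤ ε * δ ^ ((1:ℝ) / 3))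

/-- Conclusion C of the crux (SLE₆ for every Dobrushin domain and every discretisation family),
verbatim. -/
def SLESixAllFamilies : Prop :=
  ∀ (D : Literature.Probability.RandomPlanarGeometry.DobrushinDomain) (Λ : ℝ → Literature.Probability.LatticeModels.DiscreteDobrushin), (∀ δ, (Λ δ).Ω = D.carrier) → (∀ δ, (Λ δ).δ = δ) → Tendsto (fun δ : ℝ => Metric.hausdorffEDist (Λ δ).arcA (D.arc 0)) (𝓝[>] (0:ℝ)) (𝓝 0) → Tendsto (fun δ : ℝ => Metric.hausdorffEDist (Λ δ).arcB (D.arc 1)) (𝓝[>] (0:ℝ)) (𝓝 0) → Tendsto (fun δ : ℝ => Metric.hausdorffEDist (Literature.Probability.LatticeModels.medialPoint δ '' (Λ δ).zdABEdges) {D.pt 0, D.pt 1}) (𝓝[>] (0:ℝ)) (𝓝 0) → (∀ᶠ δ in 𝓝[>] (0:ℝ), (Λ δ).IsZdAdmissible) → Literature.Probability.RandomPlanarGeometry.ConvergesInLawToSLE 6 D (Ωδ := fun _ => Literature.Probability.Percolation.BondConfig (Literature.Probability.LatticeModels.Site 2)) (fun δ ω => Literature.Probability.RandomPlanarGeometry.CurveClass.mk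 (if dist (Literature.Probability.LatticeModels.medialExplorationCurve (Λ δ) ω 0) (D.pt 0) ≤ dist (Literature.Probability.LatticeModels.medialExplorationCurve (Λ δ) ω 0) (D.pt 1) then (⟨Literature.Probability.LatticeModels.medialExplorationCurve (Λ δ) ω⟩ : Literature.Probability.RandomPlanarGeometry.Curve ℂ) else ⟨(Literature.Probability.LatticeModels.medialExplorationCurve (Λ δ) ω).comp ⟨unitInterval.symm, unitInterval.continuous_symm⟩⟩)) (fun _ => Literature.Probability.Percolation.bondPercolation (Literature.Probability.LatticeModels.zdGraph 2) Literature.Probability.Percolation.half)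

/-! ## §1 Vocabulary of the line -/

/-- Critical bond percolation on `ℤ²`. -/
abbrev Pc : Measure (BondConfig (Site 2)) := bondPercolation (zdGraph 2) half

/-- The spin-1/3 vertex parafermion of the discrete Dobrushin datum `E` at the medial vertex `z`
(the `F δ z` of the crux when `E = Λ δ`, mesh read off the datum). (source: DuminilCopinSmirnov2012Lattice, §8.3.1) -/
def obs (E : DiscreteDobrushin) (z : MedialVertex) : ℂ :=
  ∫ ω, MedialPath.passageSum (medialExploration E ω) E.δ (1 / 3) z ∂Pc

/-- Direction angle of the FIRST medial step of the exploration of `E` (the corner `(v_A, f_a)` at the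
start edge `e_a`; `ω`-independent for admissible data by `IsMedialExploration.start`, here read off
the exploration of the empty configuration; junk `0` for degenerate data). -/
def startAngle (E : DiscreteDobrushin) : ℝ :=
  match medialExploration E ∅ with
  | e₀ :: e₁ :: _ => Complex.arg (medialPoint E.δ e₁ - medialPoint E.δ e₀)
  | _ => 0

/-- The ABSOLUTELY ANCHORED observable: `e^{-iσα}·obs` with `α = startAngle E`. The tree's winding is
measured from the first step (`winding` of the polyline prefix = unwrapped direction minus `α`), so
`aobs E z = E[∑_passages exp(-(i/3)·(absolute unwrapped direction of travel at z))]`; two data with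
different start-edge directions become comparable, up to the cube root of unity left by the
unwrapping base point `α ∈ (-π, π]`. -/
def aobs (E : DiscreteDobrushin) (z : MedialVertex) : ℂ :=
  Complex.exp (-(Complex.I / 3) * (startAngle E : ℂ)) * obs E z

/-- The start-direction anchoring is a unit phase: `‖aobs E z‖ = ‖obs E z‖` (registered glue sub-goal
of the skeleton: it moves bounds between the `obs`-stated `UniformPrecompact` / hypothesis B and the
`aobs`-stated `CarrierEquicontinuity` / `IdentifiedLimit`). -/
theorem norm_aobs : ∀ (E : DiscreteDobrushin) (z : MedialVertex), ‖aobs E z‖ = ‖obs E z‖ := by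
  intro E z
  have h : -(Complex.I / 3) * (startAngle E : ℂ) = ((-(startAngle E) / 3 : ℝ) : ℂ) * Complex.I := by
    push_cast; ring
  rw [aobs, norm_mul, h, Complex.norm_exp_ofReal_mul_I, one_mul]

/-- Square resampling: the configuration agreeing with `ω` on the INNER edges of `Q` (both
endpoints in `Q`) and with `ξ` on all other edges. -/
def splice (Q : Set (Site 2)) (ξ ω : BondConfig (Site 2)) : BondConfig (Site 2) :=
  {e | (e ∈ ω ∧ ∀ x ∈ e, x ∈ Q) ∨ (e ∈ ξ ∧ ¬ ∀ x ∈ e, x ∈ Q)}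

/-- The CONDITIONAL inner amplitude at `z` given the full outer configuration `ξ` off the square `Q`:
the twisted passage sum (full phase from `e_a`) integrated over a fresh percolation inside `Q`
(triage r1-1/r1-2 sharpening of the card's P1: condition on the whole outer configuration, not on a
piece decomposition). By independence of disjoint edge sets `obs E z = ∫ condObs E Q ξ z dPc(ξ)`. -/
def condObs (E : DiscreteDobrushin) (Q : Set (Site 2)) (ξ : BondConfig (Site 2))
    (z : MedialVertex) : ℂ :=
  ∫ ω, MedialPath.passageSum (medialExploration E (splice Q ξ ω)) E.δ (1 / 3) z ∂Pc

/-- The lattice square of sup-radius `n` about the site `a`. -/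
def latticeBox (a : Site 2) (n : ℕ) : Set (Site 2) := {x | ∀ i, |x i - a i| ≤ n}

/-- The spin-1/3 HALF-PLANE martingale observable of a chordal Loewner chain (percolation analogue of
the tree's `Loewner.fkObservable`, exponent `1/3` instead of `1/2`):
`(z·g_t'(z)/(g_t(z) - W_t))^{1/3}`, principal cube root (the density has positive real part in the
short-time regime, so this is the branch continuous in `t` from `1`). Far field:
`1 + W_t/(3z) + ((2/9)W_t² - (4/3)t)/z² + O(α³)`, whence `W`, `W² - 6t` martingales (κ = 6).
(source: DuminilCopin2012Parafermion, p. 9) (source: CDHKSCRAS2014, §3) -/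
def paraObservable (W : ℝ≥0 → ℝ) (t : ℝ≥0) (z : ℂ) : ℂ :=
  (z * deriv (Loewner.map W t) z / (Loewner.map W t z - W t)) ^ ((3 : ℂ)⁻¹)

/-- The time-limited spin-1/3 observable process at `z = iy`, horizon `T(iy) = y²/9`
(`Loewner.cdhksTime`), for a process `W` — the percolation twin of `Loewner.observableProcess`. -/
def paraObservableProcess {Ω : Type*} (W : ℝ≥0 → Ω → ℝ) (y : ℝ) : ℝ≥0 → Ω → ℂ :=
  fun t ω ↦ paraObservable (fun u ↦ W u ω) (min t (Loewner.cdhksTime y)) (Complex.I * y)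

/-! ## §2 The typed statements of the line -/

/-- **K1 — Koebe's shadow on squares, conditional form.** There is an absolute constant `C` such that
for every admissible datum `E`, every site `a` whose closed `3nδ`-ball lies in the carrier and every
outer configuration `ξ`, the conditional twisted passage amplitude at a lattice edge at `a`, resampled
inside the lattice square `Q(a, n)`, is at most `C·n^{-1/3}` — the conjectured `(δ/depth)^{1/3}`
envelope (DCS Conj. 8.7 + Koebe), i.e. a UNIFORM `n^{-1/12}` winding-phase cancellation beyond the
mixed two-arm bound `n^{-1/4}`, uniformly in the boundary condition that `ξ` induces on `∂Q`.
(source: DuminilCopinSmirnov2012Lattice, Conjecture 8.7) -/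
def KoebeShadowSquares : Prop :=
  ∃ C : ℝ, ∀ E : DiscreteDobrushin, E.IsZdAdmissible → ∀ (a : Site 2) (n : ℕ), 1 ≤ n →
    Metric.closedBall (meshPoint E.δ a) (3 * n * E.δ) ⊆ E.Ω →
    ∀ (ξ : BondConfig (Site 2)) (z : MedialVertex), z ∈ (zdGraph 2).edgeSet → a ∈ z →
      ‖condObs E (latticeBox a n) ξ z‖ ≤ C * (n : ℝ) ^ (-(1:ℝ) / 3)

/-- **U′ — Carathéodory (Hausdorff) equicontinuity of the observable in the carrier, at FIXED mesh.**
For carriers inside `B(0, R)`, an evaluation edge `z` at depth `≥ r` in both carriers, and `ε > 0`,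
there are `θ, δ₀ > 0` such that two admissible data of the same mesh `δ < δ₀` whose DISCRETE wired
arcs and dual-wired arcs are `θ`-close in Hausdorff distance have absolutely anchored observables at
`z` within `ε·δ^{1/3}`, up to a cube root of unity (the unwrapping ambiguity). Mechanism (card K2 +
P1): square resampling `obs = ∫ condObs dPc(ξ)`, phase-FREE macroscopic locality of the outer
arm/arc-connectivity structure (RSW couplings), and K1 on the square:
`θ_r(d)·r^{1/4}·C(δ/r)^{1/3} = o(δ^{1/3})`. (source: GarbanPeteSchramm2013, §3–5) (source: Smirnov2001, §2) -/
def CarrierEquicontinuity : Prop :=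
  ∀ R r ε : ℝ, 0 < R → 0 < r → 0 < ε → ∃ θ > (0:ℝ), ∃ δ₀ > (0:ℝ),
    ∀ E E' : DiscreteDobrushin, E.IsZdAdmissible → E'.IsZdAdmissible → E'.δ = E.δ → E.δ < δ₀ →
      E.Ω ⊆ Metric.ball 0 R → E'.Ω ⊆ Metric.ball 0 R →
      Metric.hausdorffDist (meshPoint E.δ '' E.zdArcA) (meshPoint E.δ '' E'.zdArcA) ≤ θ →
      Metric.hausdorffDist (meshPoint E.δ '' E.zdArcB) (meshPoint E.δ '' E'.zdArcB) ≤ θ →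
      ∀ z : MedialVertex, z ∈ (zdGraph 2).edgeSet →
        Metric.closedBall (medialPoint E.δ z) r ⊆ E.Ω → Metric.closedBall (medialPoint E.δ z) r ⊆ E'.Ω →
        ∃ ρ : ℂ, ρ ^ 3 = 1 ∧ ‖aobs E z - ρ * aobs E' z‖ ≤ ε * E.δ ^ ((1:ℝ) / 3)

/-- **IDENT — identification on fixed Jordan carriers** (the shared stub with card
`iic-trace-flux-pairing`; DCS Conj. 8.7 in family form): a universal constant `c ≠ 0` such that for
every Dobrushin domain, every discretisation family (arcs and marks converging), every chordal
uniformizing map `φ : ℍ → D` and every holomorphic cube root `g` of `(φ⁻¹)′/φ⁻¹` (= π·Φ′ for the strip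
map `Φ`, `a ↦ -∞`, `b ↦ +∞`), the absolutely anchored observable satisfies
`δ^{-1/3}·aobs (Λ δ) z = ρ_δ·c·g(z_δ) + o(1)` uniformly on the lattice edges over every compact, with
`ρ_δ` a sixth root of unity (cube root: unwrapping base; sign: which marked point the exploration
starts from). Carries the non-degeneracy input N (`c ≠ 0`) and the boundary identification that
`Disproof.lean` §5 shows A ∧ B cannot supply. (source: DuminilCopinSmirnov2012Lattice, Conjecture 8.7)
(source: DuminilCopin2012Parafermion, Prop. 5) -/
def IdentifiedLimit : Prop :=
  ∃ c : ℂ, c ≠ 0 ∧ ∀ (D : DobrushinDomain) (Λ : ℝ → DiscreteDobrushin), ZdDiscretisationFamily D Λ →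
    ∀ φ : ConformalEquiv UpperHalfPlane.upperHalfPlaneSet D.carrier, D.IsChordalUniformizing φ →
    ∀ g : ℂ → ℂ, DifferentiableOn ℂ g D.carrier →
      (∀ w ∈ D.carrier, g w ^ 3 = deriv (fun u => φ.symm u) w / φ.symm w) →
      ∀ K : Set ℂ, IsCompact K → K ⊆ D.carrier → ∀ ε > (0:ℝ), ∀ᶠ δ in 𝓝[>] (0:ℝ),
        ∃ ρ : ℂ, ρ ^ 6 = 1 ∧ ∀ z : MedialVertex, z ∈ (zdGraph 2).edgeSet → medialPoint δ z ∈ K →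
          ‖aobs (Λ δ) z - ρ * c * ((δ ^ ((1:ℝ) / 3) : ℝ) : ℂ) * g (medialPoint δ z)‖ ≤
            ε * δ ^ ((1:ℝ) / 3)

/-- Local boundedness at scale `δ^{1/3}`, UNIFORM over all admissible discrete Dobrushin data with the
given carrier, for every carrier that admits at least one eventually-admissible family (`Sketch.
UniformPrecompact`; provable from B: `firstLemmaB` below). -/
def UniformPrecompact : Prop :=
  ∀ (D : DobrushinDomain),
    (∃ Λ : ℝ → DiscreteDobrushin, (∀ δ, (Λ δ).Ω = D.carrier) ∧ (∀ δ, (Λ δ).δ = δ) ∧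
      ∀ᶠ δ in 𝓝[>] (0:ℝ), (Λ δ).IsZdAdmissible) →
    ∀ K : Set ℂ, IsCompact K → K ⊆ D.carrier →
      ∃ C : ℝ, ∀ᶠ δ in 𝓝[>] (0:ℝ), ∀ E : DiscreteDobrushin, E.Ω = D.carrier → E.δ = δ →
        E.IsZdAdmissible → ∀ z : MedialVertex, z ∈ (zdGraph 2).edgeSet →
        medialPoint δ z ∈ K → ‖obs E z‖ ≤ C * δ ^ ((1:ℝ) / 3)

/-- The discrete-martingale approximation data (D) for the spin-1/3 observable along the meshes
`u k`, for processes `V k` on the percolation space: at every scale a discrete filtration, a complex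
martingale (the conditional twisted passage amplitude given the exploration prefix, normalised by
`e^{-iσW(a→tip)}`, `ρ̄ c⁻¹ δ^{-1/3}` and the `t`-independent factor `((φ⁻¹)′(z))^{-1/3}`, stopped when
the exploration leaves the far-field regime) and lattice stopping steps whose stopped values
approximate `paraObservableProcess (V k) y` within `ε_k` off an event of probability `≤ η_k` —
literally the hypothesis `hD` of the tree's abstract passage theorem
`Loewner.integral_cylinder_eq_zero_of_tendstoInDistribution`, for `paraObservableProcess`. -/
def ParaMartingaleApprox (V : ℕ → ℝ≥0 → BondConfig (Site 2) → ℝ) : Prop :=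
  ∀ y : ℝ, 0 < y → ∀ s t : ℝ≥0, s < t → t < Loewner.cdhksTime y →
    ∃ (C' : ℝ) (ε Δ η : ℕ → ℝ≥0), Tendsto ε atTop (𝓝 0) ∧ Tendsto Δ atTop (𝓝 0) ∧
      Tendsto η atTop (𝓝 0) ∧
      ∀ k, ∃ (𝒢 : Filtration ℕ (inferInstance : MeasurableSpace (BondConfig (Site 2))))
        (F : ℕ → BondConfig (Site 2) → ℂ) (σ τ : BondConfig (Site 2) → WithTop ℕ)
        (hσ : IsStoppingTime 𝒢 σ) (M : ℕ) (bad : Set (BondConfig (Site 2))),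
        IsStoppingTime 𝒢 τ ∧ Martingale F 𝒢 Pc ∧ σ ≤ τ ∧ (∀ ω, τ ω ≤ M) ∧
        (∀ u, u ≤ s → Measurable[hσ.measurableSpace] (V k u)) ∧
        (∀ᵐ ω ∂Pc, ‖stoppedValue F σ ω‖ ≤ C') ∧ (∀ᵐ ω ∂Pc, ‖stoppedValue F τ ω‖ ≤ C') ∧
        MeasurableSet bad ∧ Pc bad ≤ η k ∧
        ∀ᵐ ω ∂Pc, ω ∉ bad →
          (∃ u ∈ Icc s (s + Δ k), ‖stoppedValue F σ ω - paraObservableProcess (V k) y u ω‖ ≤ ε k) ∧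
          (∃ u ∈ Icc t (t + Δ k), ‖stoppedValue F τ ω - paraObservableProcess (V k) y u ω‖ ≤ ε k)

/-- **U — the slit-uniform martingale data** (the line's own output, in the (J′)+(D) shape of
`LatticeModels/InterfaceSLELimitData.lean`). For every Dobrushin domain, discretisation family,
meshes `u n → 0⁺` and probability measure `ν` to which the interface laws converge weakly: a chordal
uniformizing map `φ` through which `ν`-a.e. curve is Loewner-describable and starts at `a`
(Kemppainen–Smirnov 2017 Thm 1.5 / Cor 1.7 from Condition G2 = RSW on `ℤ²`), continuous-path capacity
driving processes `V k` of the discrete interfaces converging in distribution to the driving function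
of `ν`, and the discrete observable martingale data `ParaMartingaleApprox V`. The LINE: the exact
discrete martingale `n ↦ E[X_z | 𝓕_n]` (domain Markov property of `medialExploration`, trivial for the
product measure) is within `o(δ^{1/3})` of `c·δ^{1/3}·(observable of the slit domain)` UNIFORMLY over
the slit domains on the tightness event — by Carathéodory/Hausdorff compactness of the fattened slit
data, `IdentifiedLimit` on the Jordan approximants, `CarrierEquicontinuity` (equicontinuity ⇒ uniform
convergence, Arzelà–Ascoli/Dini) and once more `CarrierEquicontinuity` to pass from the conditional
amplitude to the observable of a close admissible datum; `UniformPrecompact` bounds the stopped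
martingale. (source: KemppainenSmirnov2017, Thm. 1.5 and Cor. 1.7) (source: CDHKSCRAS2014, §3) -/
def SlitMartingaleData : Prop :=
  ∀ (D : DobrushinDomain) (Λ : ℝ → DiscreteDobrushin), ZdDiscretisationFamily D Λ →
    ∀ (u : ℕ → ℝ), Tendsto u atTop (𝓝[>] (0:ℝ)) →
    ∀ (ν : Measure (CurveClass ℂ)) [IsProbabilityMeasure ν],
      (∀ f : CurveClass ℂ →ᵇ ℝ,
        Tendsto (fun n => ∫ ω, f (Literature.Probability.Percolation.bondInterfaceIn D (Λ (u n)) ω) ∂Pc) atTop (𝓝 (∫ x, f x ∂ν))) →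
      ∃ φ : ConformalEquiv UpperHalfPlane.upperHalfPlaneSet D.carrier, D.IsChordalUniformizing φ ∧
        (∀ᵐ c ∂ν, IsLoewnerDescribable φ c) ∧ (∀ᵐ c ∂ν, c.source = D.pt 0) ∧
        ∃ (V : ℕ → ℝ≥0 → BondConfig (Site 2) → ℝ) (hVc : ∀ k ω, Continuous (V k · ω)),
          TendstoInDistribution (fun k ω ↦ (⟨fun t ↦ V k t ω, hVc k ω⟩ : C(ℝ≥0, ℝ))) atTop
            (fun c ↦ (⟨drivingFunction φ c, continuous_drivingFunction φ c⟩ : C(ℝ≥0, ℝ)))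
            (fun _ => Pc) ν ∧
          ParaMartingaleApprox V

/-- **SLE₆ from the limit data** (the κ = 6 twin of `isSLELaw_three_of_limitData`): for one limit law
`ν` and one chordal uniformizing map, (J′)+(D) for the spin-1/3 observable identify `ν` as the chordal
SLE₆ law. Content, all provable now by cloning the spin files with exponent `1/3`: joint continuity and
boundedness of `(u, w) ↦ paraObservableProcess` on `[0, T(iy)]` (the density has positive real part),
the abstract passage `Loewner.integral_cylinder_eq_zero_of_tendstoInDistribution`, the far-field
expansion `(1+u)^{1/3}` of the density `1 + W/z + (W² - 4t)/z² + O(α³)` (`FarRegime.norm_density_sub_le`)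
giving the local martingales `W` and `W² - 6t`, Lévy (`Process.levy_characterisation_holds`) and the
κ-local transport `isSLELaw_of_isLocalMartingale_driving_through` with `exists_isSLECurve_six`.
(source: DuminilCopin2012Parafermion, p. 9) (source: CDHKSCRAS2014, §3) -/
def SleSixOfLimitData : Prop :=
  ∀ (D : DobrushinDomain) (φ : ConformalEquiv UpperHalfPlane.upperHalfPlaneSet D.carrier),
    D.IsChordalUniformizing φ →
    ∀ (ν : Measure (CurveClass ℂ)) [IsProbabilityMeasure ν],
      (∀ᵐ c ∂ν, IsLoewnerDescribable φ c) → (∀ᵐ c ∂ν, c.source = D.pt 0) →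
      ∀ (V : ℕ → ℝ≥0 → BondConfig (Site 2) → ℝ) (hVc : ∀ k ω, Continuous (V k · ω)),
        TendstoInDistribution (fun k ω ↦ (⟨fun t ↦ V k t ω, hVc k ω⟩ : C(ℝ≥0, ℝ))) atTop
          (fun c ↦ (⟨drivingFunction φ c, continuous_drivingFunction φ c⟩ : C(ℝ≥0, ℝ)))
          (fun _ => Pc) ν →
        ParaMartingaleApprox V → IsSLELaw 6 D ν

/-- **Tightness of the interface laws of discretisation FAMILIES** (Aizenman–Burchard from RSW/BK on
`ℤ²`; the tree proves the canonical-data case `isTightLaws_map_bondInterface_holds`,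
`InterfaceTraversalBound.lean`; the same proof for arbitrary admissible data with carrier `D`).
(source: AizenmanBurchard1999, Thm. 1.2 and App. A) -/
def TightFamilies : Prop :=
  ∀ (D : DobrushinDomain) (Λ : ℝ → DiscreteDobrushin), ZdDiscretisationFamily D Λ →
    IsTightAlongMesh (Ωδ := fun _ => BondConfig (Site 2)) (fun δ ↦ Literature.Probability.Percolation.bondInterfaceIn D (Λ δ))
      (fun _ => Pc)

/-! ## §3 Reshape r1 (lead, 2026-08-16): the prime-end-aware form of U′

Wave 1 found the registered `CarrierEquicontinuity` inconsistent with `IdentifiedLimit` (worker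
verdict `stub-false`, evidence `Cruxes/ParafermionToSLESixFamilies/Lines/caratheodory-net-slit-uniformity.lean`
docstring and the item's evidence note): Hausdorff closeness of the labelled SITE clouds sees neither
prime ends (the two faces of a `δ`-thin wall are `δ`-close: square minus a thin notch, marks at
mirror-image corners of the notch, `|Φ′_E/Φ′_{E′}|^{1/3} ≈ 2` at deep points) nor the topology of
the face domain (a wired island vs a dual-wired island behind a gapped double wall). The repaired
statement compares ORIENTED labelled boundary medial darts (opposite faces of a wall, and wired vs
dual-wired islands, carry opposite orientations) and asks the face domain to be simply connected
(the non-inner faces form one `ℤ²`-connected sea). It replaces `CarrierEquicontinuity` in the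
skeleton (stubs `stub_carrierEquicontinuity'`, `stub_percParaApprox`); nothing is asserted. -/

/-- Oriented labelled boundary darts of `E` at the sites of `S`, as (base point, direction/δ) pairs
in `ℂ × ℂ`: the medial darts `cornerSource v f → cornerTarget v f` through INNER faces `f` at sites
`v ∈ S` (primal vertex on the left), reversed when `rev` (along the dual-wired arc the exploration
keeps the site on its RIGHT). Directions have norm `1/√2`; distinct directions are at distance `≥ 1`,
so `θ`-closeness with `θ < 1` matches darts direction by direction. -/
def bdDarts (E : DiscreteDobrushin) (S : Set (Site 2)) (rev : Bool) : Set (ℂ × ℂ) :=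
  {p | ∃ v f : Site 2, IsCorner v f ∧ E.IsInnerFace f ∧ v ∈ S ∧
    p = (if rev then medialPoint E.δ (cornerTarget v f) else medialPoint E.δ (cornerSource v f),
      (if rev then -1 else 1) * (E.δ : ℂ)⁻¹ *
        (medialPoint E.δ (cornerTarget v f) - medialPoint E.δ (cornerSource v f)))}

/-- **U′ (reshape r1) — prime-end-aware Carathéodory equicontinuity of the observable in the
carrier, at FIXED mesh.** As `CarrierEquicontinuity`, but for data whose face domains are simply
connected (the non-inner faces induce a preconnected subgraph of `ℤ²`) and with `θ`-closeness of the
ORIENTED labelled boundary dart clouds `bdDarts` (wired arc: site on the left; dual-wired arc: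
reversed) in place of the labelled site clouds: two such admissible data of the same mesh `δ < δ₀`
have absolutely anchored observables at an `r`-deep lattice edge within `ε·δ^{1/3}`, up to a cube root
of unity. Survives the two wave-1 witnesses (mirror-marked notch: opposite dart orientations on the
two faces; relabelled island: excluded by preconnectedness); still of Garban–Pete–Schramm coupling
strength (source: GarbanPeteSchramm2013, §3–5). -/
def CarrierEquicontinuity' : Prop :=
  ∀ R r ε : ℝ, 0 < R → 0 < r → 0 < ε → ∃ θ > (0:ℝ), ∃ δ₀ > (0:ℝ),
    ∀ E E' : DiscreteDobrushin, E.IsZdAdmissible → E'.IsZdAdmissible → E'.δ = E.δ → E.δ < δ₀ →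
      E.Ω ⊆ Metric.ball 0 R → E'.Ω ⊆ Metric.ball 0 R →
      ((zdGraph 2).induce {f | ¬ E.IsInnerFace f}).Preconnected →
      ((zdGraph 2).induce {f | ¬ E'.IsInnerFace f}).Preconnected →
      Metric.hausdorffDist (bdDarts E E.zdArcA false) (bdDarts E' E'.zdArcA false) ≤ θ →
      Metric.hausdorffDist (bdDarts E E.zdArcB true) (bdDarts E' E'.zdArcB true) ≤ θ →
      ∀ z : MedialVertex, z ∈ (zdGraph 2).edgeSet →
        Metric.closedBall (medialPoint E.δ z) r ⊆ E.Ω → Metric.closedBall (medialPoint E.δ z) r ⊆ E'.Ω →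
        ∃ ρ : ℂ, ρ ^ 3 = 1 ∧ ‖aobs E z - ρ * aobs E' z‖ ≤ ε * E.δ ^ ((1:ℝ) / 3)

end Summit.CriticalPhenomena.CardyFormulaZ2.Cruxes.ParafermionToSLESixFamilies.CaratheodoryNetSlitUniformity

end
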